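import Summits.Ventures.PackingBounds.ThreePointCert.K6d10Cert

/-!
# κ(6) ≤ 78: kernel validation of Gram block R0 (chunks 31–35 of 44)

Framing: lottery ticket; floor = certified bounds/negative ranges. Venture `PackingBounds` (cell
`pub-packcert`), three-point SDP family. Integer data of a feasible point of the Bachoc–Vallentin
semidefinite program (n = 6, s = 1/2, degree d = 10, symmetric
sums of squares), derived by `pub-packcert-lp/code/lean3pt/cert2lean_lp.py` (the lp seat's fixed-point
variant of `pub-packcert-sdp/code/lean3pt/cert2lean.py`) from the exact rational certificate
`sdp-d6-deg10-sym-lp-v1.json` of the cell (exact verifier #1 + verifier #2 of the other seat), in the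
units of the kernel checker `ThreePointCert.Check` (soundness `ThreePointCert.Sound`). Generated
file: plain lists of integers / monomials.
-/

namespace Summit.Ventures.PackingBounds.ThreePointCert.K6d10

open Literature.Geometry.DiscreteGeometry Literature.Geometry.DiscreteGeometry.PolyCert PolyCert.SPoly

set_option maxHeartbeats 0 in
/-- Block `R0`: rows from 231 (5 rows) of `zᵀ(LLᵀ)z` added to `dR0c30` give `dR0c31` (kernel). -/
theorem okR0_31 : chunkOK K6d10.gR0 231 5 K6d10.dR0c30 K6d10.dR0c31 = true := by
  decide +kernel

set_option maxHeartbeats 0 in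
/-- Block `R0`: rows from 236 (5 rows) of `zᵀ(LLᵀ)z` added to `dR0c31` give `dR0c32` (kernel). -/
theorem okR0_32 : chunkOK K6d10.gR0 236 5 K6d10.dR0c31 K6d10.dR0c32 = true := by
  decide +kernel

set_option maxHeartbeats 0 in
/-- Block `R0`: rows from 241 (4 rows) of `zᵀ(LLᵀ)z` added to `dR0c32` give `dR0c33` (kernel). -/
theorem okR0_33 : chunkOK K6d10.gR0 241 4 K6d10.dR0c32 K6d10.dR0c33 = true := by
  decide +kernel

set_option maxHeartbeats 0 in
/-- Block `R0`: rows from 245 (4 rows) of `zᵀ(LLᵀ)z` added to `dR0c33` give `dR0c34` (kernel). -/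
theorem okR0_34 : chunkOK K6d10.gR0 245 4 K6d10.dR0c33 K6d10.dR0c34 = true := by
  decide +kernel

set_option maxHeartbeats 0 in
/-- Block `R0`: rows from 249 (4 rows) of `zᵀ(LLᵀ)z` added to `dR0c34` give `dR0c35` (kernel). -/
theorem okR0_35 : chunkOK K6d10.gR0 249 4 K6d10.dR0c34 K6d10.dR0c35 = true := by
  decide +kernel

end Summit.Ventures.PackingBounds.ThreePointCert.K6d10
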